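import Mathlib
import HarnessLib

/-!
# LatticeQCDFlow / Scaling — the Gaussian acceptance formula `acc = 2Φ(-s/2)` (T2-J, the `erfc` cell)

HONEST FRAMING: exact (Metropolis-corrected) sampling algorithms for lattice gauge theory; figures of merit are
autocorrelation/cost numbers at stated couplings and volumes; no continuum-physics claim.

Venture `LatticeQCDFlow` (cell pub-lqcd), topic `Scaling`, FANOUT row 30 (lean-1) — OUR WORK, completing item T2-J of
HOME/THEORY-2.md §4 (`Scaling/GaussianWeights.lean`: "the `erfc` acceptance formula is not typed (no `erfc` in
Mathlib)").  We write `Φ(a) = (gaussianReal 0 1).real (Iic a)` for the standard normal distribution function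
(`2Φ(-x) = erfc(x/√2)`), so no special function is needed:

* `integral_min_one_exp_gaussianReal` — **the acceptance formula**: for a NORMALISED Gaussian log-ratio
  `X ∼ N(-s²/2, s²)` (`E e^X = 1`), `s² = v > 0`: `E[min(1, e^X)] = 2Φ(-s/2)`.  Proof: on `X ≥ 0` the integrand is
  `1` (mass `P(N(-v/2, v) ≥ 0) = Φ(-√v/2)`), on `X < 0` it is `e^X`, and the exponential TILT of `N(-v/2, v)` is
  `N(+v/2, v)` (`e^x·φ_{-v/2,v}(x) = φ_{v/2,v}(x)`, `gaussianPDFReal_tilt`), whose mass below `0` is again `Φ(-√v/2)`;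
* `neAcceptance_gaussian` — NE-MCMC / Jarzynski accept step: if the work `W` is Gaussian `N(v/2, v)` (the
  normalisation `⟨e^{-W}⟩ = 1` forces the mean, `gaussian_logweight_law`), the Metropolis acceptance
  `E[min(1, e^{-W})]` is `2Φ(-√v/2)`, `v = Var W`;
* `imhAcceptance_gaussian` — flow-MCMC (independence Metropolis) at stationarity in the Gaussian log-weight regime:
  current state `x ∼ p` with `ℓ(x) ∼ N(v/2, v)`, proposal `y ∼ q` with `ℓ(y) ∼ N(-v/2, v)`, independent ⟹
  `E[min(1, w(y)/w(x))] = 2Φ(-√(2v)/2) = erfc(√v/2)` (`v = Var_q log w`) — THEORY-2's printed formula.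
  READING (markdown arithmetic): `v = 1 ⇒ acc = 2Φ(-0.707) ≈ 0.48`; `v = 4 ⇒ 2Φ(-1.414) ≈ 0.157`;
  `v = 16 ⇒ 2Φ(-2.83) ≈ 0.005`: with `v = Var(log w)` extensive in the volume the acceptance of an un-annealed flow
  proposal dies like `erfc(√(cV)/2)`.

Elementary over Mathlib's `gaussianReal` (affine images `gaussianReal_map_const_mul` / `_add_const` / `_neg`,
`integral_gaussianReal_eq_integral_smul`, `gaussianReal_add_gaussianReal_of_indepFun`); nothing is cited as a fact.
Reading: Roberts–Gelman–Gilks, Ann. Appl. Probab. 7 (1997) 110 (the `2Φ(-σ/2)` acceptance of Gaussian log-ratios);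
Neal, Stat. Comput. 11 (2001) 125 §4 (annealed importance sampling).
-/

noncomputable section

namespace Summit.Ventures.LatticeQCDFlow.Theory2

open MeasureTheory ProbabilityTheory Set Real
open scoped NNReal

/-! ## §1. Standard-normal bookkeeping -/

/-- `N(m, v)` is the affine image `z ↦ √v·z + m` of `N(0, 1)`. [folklore] -/
theorem gaussianReal_eq_map_affine (m : ℝ) (v : ℝ≥0) :
    gaussianReal m v = (gaussianReal 0 1).map (fun z => √(v : ℝ) * z + m) := by
  have h1 := gaussianReal_map_const_mul (μ := 0) (v := 1) (√(v : ℝ))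
  have hv' : (NNReal.mk (√(v : ℝ) ^ 2) (sq_nonneg _)) * 1 = v := by
    ext
    rw [mul_one, NNReal.coe_mk, Real.sq_sqrt v.coe_nonneg]
  rw [mul_zero, hv'] at h1
  have h2 := gaussianReal_map_add_const (μ := 0) (v := v) m
  rw [zero_add] at h2
  rw [← h2, ← h1, Measure.map_map (measurable_add_const m) (measurable_const_mul _)]
  rfl

/-- Masses of `N(m, v)` are masses of `N(0, 1)` on affine preimages. [folklore] -/
theorem gaussianReal_real_eq_affine (m : ℝ) (v : ℝ≥0) {s : Set ℝ} (hs : MeasurableSet s) :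
    (gaussianReal m v).real s = (gaussianReal 0 1).real ((fun z => √(v : ℝ) * z + m) ⁻¹' s) := by
  rw [Measure.real, Measure.real, gaussianReal_eq_map_affine m v,
    Measure.map_apply ((measurable_const_mul _).add_const m) hs]

/-- Symmetry of `N(0, 1)`: `P(Z ≥ a) = P(Z ≤ -a) = Φ(-a)`. [folklore] -/
theorem stdGaussian_real_Ici (a : ℝ) :
    (gaussianReal 0 1).real (Ici a) = (gaussianReal 0 1).real (Iic (-a)) := by
  have h := gaussianReal_map_neg (μ := 0) (v := 1)
  rw [neg_zero] at h
  have hpre : (fun x : ℝ => -x) ⁻¹' Iic (-a) = Ici a := by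
    ext z
    simp only [mem_preimage, mem_Iic, neg_le_neg_iff, mem_Ici]
  conv_rhs => rw [← h]
  rw [Measure.real, Measure.real, Measure.map_apply measurable_neg measurableSet_Iic, hpre]

/-- No atoms: `P(Z < a) = P(Z ≤ a)` for `N(0, 1)`. [folklore] -/
theorem stdGaussian_real_Iio (a : ℝ) :
    (gaussianReal 0 1).real (Iio a) = (gaussianReal 0 1).real (Iic a) := by
  haveI := nullSingletonClass_gaussianReal (μ := 0) (v := 1) one_ne_zero
  rw [Measure.real, Measure.real, measure_congr (Iio_ae_eq_Iic (μ := gaussianReal 0 1) (a := a))]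

/-- **The exponential tilt of `N(-v/2, v)` is `N(v/2, v)`**: `e^x·φ_{-v/2,v}(x) = φ_{v/2,v}(x)`. [folklore] -/
theorem gaussianPDFReal_tilt {v : ℝ≥0} (hv : v ≠ 0) (x : ℝ) :
    gaussianPDFReal (-((v : ℝ) / 2)) v x * rexp x = gaussianPDFReal ((v : ℝ) / 2) v x := by
  have hvpos : 0 < (v : ℝ) := lt_of_le_of_ne v.coe_nonneg (fun h => hv (by exact_mod_cast h.symm))
  rw [gaussianPDFReal, gaussianPDFReal, mul_assoc, ← Real.exp_add]
  congr 2
  field_simp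
  ring

/-! ## §2. The acceptance formula -/

/-- **`E[min(1, e^X)] = 2Φ(-s/2)` for `X ∼ N(-s²/2, s²)`** (`s² = v ≠ 0`; `E e^X = 1`): the Metropolis acceptance of a
normalised Gaussian log-ratio. [folklore] -/
theorem integral_min_one_exp_gaussianReal {v : ℝ≥0} (hv : v ≠ 0) :
    ∫ x, min 1 (rexp x) ∂gaussianReal (-((v : ℝ) / 2)) v =
      2 * (gaussianReal 0 1).real (Iic (-(√(v : ℝ) / 2))) := by
  set m : ℝ := (v : ℝ) / 2 with hm
  set σ : ℝ := √(v : ℝ) with hσdef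
  have hvpos : 0 < (v : ℝ) := lt_of_le_of_ne v.coe_nonneg (fun h => hv (by exact_mod_cast h.symm))
  have hσ : 0 < σ := Real.sqrt_pos.2 hvpos
  have hσ2 : σ ^ 2 = (v : ℝ) := Real.sq_sqrt hvpos.le
  have hm2 : m = σ * (σ / 2) := by
    rw [hm, ← hσ2]; ring
  -- integrability of the bounded continuous integrand
  have hint : Integrable (fun x => min 1 (rexp x)) (gaussianReal (-m) v) := by
    refine Integrable.mono' (integrable_const (1 : ℝ))
      ((continuous_const.min Real.continuous_exp).aestronglyMeasurable) (ae_of_all _ fun x => ?_)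
    rw [Real.norm_eq_abs, abs_of_nonneg (le_min zero_le_one (Real.exp_pos x).le)]
    exact min_le_left _ _
  -- split at `0`
  rw [← integral_add_compl (measurableSet_Ici : MeasurableSet (Ici (0 : ℝ))) hint, compl_Ici]
  -- Term A: on `x ≥ 0` the integrand is `1`
  have hA : ∫ x in Ici (0 : ℝ), min 1 (rexp x) ∂gaussianReal (-m) v = (gaussianReal (-m) v).real (Ici 0) := by
    rw [setIntegral_congr_fun measurableSet_Ici (fun x (hx : 0 ≤ x) => min_eq_left (Real.one_le_exp hx)),
      setIntegral_const, smul_eq_mul, mul_one]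
  -- Term B: on `x < 0` the integrand is `e^x`, and the tilt turns `N(-m, v)` into `N(m, v)`
  have hB : ∫ x in Iio (0 : ℝ), min 1 (rexp x) ∂gaussianReal (-m) v = (gaussianReal m v).real (Iio 0) := by
    rw [setIntegral_congr_fun measurableSet_Iio
      (fun x (hx : x < 0) => min_eq_right (Real.exp_le_one_iff.2 hx.le)),
      ← integral_indicator measurableSet_Iio, integral_gaussianReal_eq_integral_smul hv]
    have hfun : (fun x => gaussianPDFReal (-m) v x • (Iio (0 : ℝ)).indicator rexp x) =
        (Iio (0 : ℝ)).indicator (gaussianPDFReal m v) := by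
      funext x
      by_cases hx : x ∈ Iio (0 : ℝ)
      · rw [indicator_of_mem hx, indicator_of_mem hx, smul_eq_mul]
        exact gaussianPDFReal_tilt hv x
      · rw [indicator_of_notMem hx, indicator_of_notMem hx, smul_zero]
    rw [hfun, integral_indicator measurableSet_Iio, Measure.real, gaussianReal_apply_eq_integral _ hv,
      ENNReal.toReal_ofReal (setIntegral_nonneg measurableSet_Iio fun x _ => gaussianPDFReal_nonneg _ _ _)]
  -- both masses are `Φ(-σ/2)`
  have hA' : (gaussianReal (-m) v).real (Ici 0) = (gaussianReal 0 1).real (Iic (-(σ / 2))) := by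
    rw [gaussianReal_real_eq_affine (-m) v measurableSet_Ici]
    have hpre : (fun z => σ * z + -m) ⁻¹' Ici (0 : ℝ) = Ici (σ / 2) := by
      ext z
      simp only [mem_preimage, mem_Ici, hm2]
      constructor <;> intro h <;> nlinarith
    rw [hpre, stdGaussian_real_Ici]
  have hB' : (gaussianReal m v).real (Iio 0) = (gaussianReal 0 1).real (Iic (-(σ / 2))) := by
    rw [gaussianReal_real_eq_affine m v measurableSet_Iio]
    have hpre : (fun z => σ * z + m) ⁻¹' Iio (0 : ℝ) = Iio (-(σ / 2)) := by
      ext z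
      simp only [mem_preimage, mem_Iio, hm2]
      constructor <;> intro h <;> nlinarith
    rw [hpre, stdGaussian_real_Iio]
  rw [hA, hB, hA', hB']
  ring

/-! ## §3. The two samplers: NE-MCMC accept step and flow-MCMC (IMH) at stationarity -/

/-- **NE-MCMC / Jarzynski acceptance in the Gaussian-work regime**: if the dissipated work `W` of a
non-equilibrium proposal is Gaussian `N(v/2, v)` (`v ≠ 0`; the mean is forced by `⟨e^{-W}⟩ = 1`), its Metropolis
acceptance is `E[min(1, e^{-W})] = 2Φ(-√v/2)`. [folklore] -/
theorem neAcceptance_gaussian {Ω : Type*} [MeasurableSpace Ω] {P : Measure Ω} {W : Ω → ℝ} (hWm : Measurable W)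
    {v : ℝ≥0} (hv : v ≠ 0) (hW : P.map W = gaussianReal ((v : ℝ) / 2) v) :
    ∫ ω, min 1 (rexp (-W ω)) ∂P = 2 * (gaussianReal 0 1).real (Iic (-(√(v : ℝ) / 2))) := by
  have hneg : P.map (fun ω => -W ω) = gaussianReal (-((v : ℝ) / 2)) v := by
    rw [show (fun ω => -W ω) = (fun x : ℝ => -x) ∘ W from rfl, ← Measure.map_map measurable_neg hWm, hW,
      gaussianReal_map_neg]
  rw [← integral_min_one_exp_gaussianReal hv, ← hneg]
  exact (integral_map (φ := fun ω => -W ω) hWm.neg.aemeasurable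
    (continuous_const.min Real.continuous_exp).aestronglyMeasurable).symm

/-- **Flow-MCMC (independence Metropolis) acceptance at stationarity in the Gaussian log-weight regime**
(THEORY-2 T2-J): the current state `x ∼ p` has `ℓ(x) = log w(x) ∼ N(v/2, v)` (the tilt of the model law), the
proposal `y ∼ q` has `ℓ(y) ∼ N(-v/2, v)`, independently; then `E[min(1, w(y)/w(x))] = E[min(1, e^{ℓ(y)-ℓ(x)})]
= 2Φ(-√(2v)/2)` (`= erfc(√v/2)`). [folklore] -/
theorem imhAcceptance_gaussian {Ω : Type*} [MeasurableSpace Ω] {P : Measure Ω} {ℓx ℓy : Ω → ℝ}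
    (hmx : Measurable ℓx) (hmy : Measurable ℓy) (hind : IndepFun ℓx ℓy P) {v : ℝ≥0} (hv : v ≠ 0)
    (hx : P.map ℓx = gaussianReal ((v : ℝ) / 2) v) (hy : P.map ℓy = gaussianReal (-((v : ℝ) / 2)) v) :
    ∫ ω, min 1 (rexp (ℓy ω - ℓx ω)) ∂P = 2 * (gaussianReal 0 1).real (Iic (-(√((2 * v : ℝ≥0) : ℝ) / 2))) := by
  have hnx : P.map (fun ω => -ℓx ω) = gaussianReal (-((v : ℝ) / 2)) v := by
    rw [show (fun ω => -ℓx ω) = (fun x : ℝ => -x) ∘ ℓx from rfl, ← Measure.map_map measurable_neg hmx, hx,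
      gaussianReal_map_neg]
  have hind' : IndepFun ℓy (fun ω => -ℓx ω) P := hind.symm.comp measurable_id measurable_neg
  have hD := gaussianReal_add_gaussianReal_of_indepFun hind' hy hnx
  have h2v : v + v = 2 * v := (two_mul v).symm
  have hmean : -((v : ℝ) / 2) + -((v : ℝ) / 2) = -(((2 * v : ℝ≥0) : ℝ) / 2) := by
    push_cast; ring
  rw [h2v, hmean] at hD
  have h2v0 : (2 * v : ℝ≥0) ≠ 0 := mul_ne_zero two_ne_zero hv
  rw [← integral_min_one_exp_gaussianReal h2v0, ← hD,
    integral_map (φ := ℓy + fun ω => -ℓx ω) (hmy.add hmx.neg).aemeasurable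
      (continuous_const.min Real.continuous_exp).aestronglyMeasurable]
  simp only [Pi.add_apply, sub_eq_add_neg]

end Summit.Ventures.LatticeQCDFlow.Theory2

end
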